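import Literature.NumberTheory.EllipticCurves.PAdicLFunctionTameMultProofs
import Literature.NumberTheory.EllipticCurves.PAdicLFunctionTameBirchMeasureProofs
import Literature.NumberTheory.EllipticCurves.PAdicLFunctionTameDepletionFactorProofs
import Literature.NumberTheory.EllipticCurves.PAdicMeasureTransformTranslationProofs
import HarnessLib

/-!
# Birch's lemma for the ONE-TERM transforms (`p ∣ N`, `ε(p) = 0`): a symbol-level twisting relation
# `[x]⁺_g = c · Σ_b χ(b) [x + b/m]⁺_f` makes the level-`1` one-term transform of `g` at `χ(p)α` equal to
# `C(c) · (1+T)^{−f_m} · L_p(f, α, χ, T)` (PROOFS ONLY: no `def`, no named fact)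

Companion of `PAdicLFunctionTameMult` (cell bsd-2adic, seat conv-1 GEN 13, road «hKan-mult»); the one-term twin of
`PAdicLFunctionTameBirchMeasureProofs` (P4b) and `PAdicLFunctionTameBirchTransformProofs` (P4c). Mazur–Tate–Teitelbaum
(Invent. Math. 84 (1986), §I.8–I.10) and Matsuno (J. Number Theory 84 (2000), §2 p. 84: "`G_{p,m}(E, χ, T)` … is the `p`-adic
`L`-function of the twist") pass from the twisted modular symbol to the twisted measure by the Chinese remainder theorem; the
shape of the measure at `p` (`ε(p) = 1` or `0`) plays no role. With `f`, `g` weight-`2` cusp forms, `χ` a `ℚ`-valued character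
mod `m`, `(m, p) = 1`, `χ(p)² = 1`, `c ∈ ℚ`, and `hB : ∀ x, [x]⁺_g = c · Σ_{b mod m} χ(b) [x + b/m]⁺_f`:

* `msdMeasureTameMult_twist_eq_sum` — `μ¹_{g, χ(p)α}(a + pⁿℤ_p) = c · Σ_b χ(b) · μ¹_{f,α,m}((a·m + pⁿℤ_p) × {b})`
  (`sum_mul_ratPlusSymbol_tameFraction_eq` of the two-term file: `Σ_b χ(b)[tameFraction(n, am, b)]⁺ = χ(pⁿ)Σ_b χ(b)[a/pⁿ + b/m]⁺`);
* `padicLRiemannSumTameMult_twist_eq` — the Riemann sums of `g` are `c` times the TRANSLATED (by `m ≡ ω(m)γ^{f_m}`) weighted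
  tame sums of `f`;
* `padicLCoeffTameMult_twist_eq`, **`padicLFunctionTameMult_twist_eq_of_birch`** — for `f` a rational normalised newform with
  `p ∣ N`, `a_p(f) = α`, `‖α‖ = 1`: `padicLFunctionTameMult g 1 (χ(p)α) 1 = C(c) · (1+T)^{−f_m} · padicLFunctionTameMult f m α χ`
  (`tendsto_riemannSum_translate`). When `g` is the newform of the quadratic twist and `χ(p)α = a_p(g)`, the left side is THE
  package `p`-adic `L`-function of the twist (`PAdicLFunctionTameMultProofs` §4).

References: B. Mazur, J. Tate, J. Teitelbaum, Invent. Math. 84 (1986), §I.8–§I.13 [MazurTateTeitelbaum1986Invent]; K. Matsuno,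
J. Number Theory 84 (2000), §2 (p. 84) [Matsuno2000].
-/

noncomputable section

open scoped MatrixGroups ModularForm

open CongruenceSubgroup Filter Topology PowerSeries Literature.NumberTheory.EllipticCurves.ModularForms
  Literature.NumberTheory.EllipticCurves.GreenbergVatsal2000

namespace Literature.NumberTheory.EllipticCurves

section Birch

variable {N N' : ℕ} [NeZero N] [NeZero N'] (f : CuspForm (Gamma0 N) 2) (g : CuspForm (Gamma0 N') 2)
  {p : ℕ} [Fact p.Prime] {m : ℕ} [NeZero m]

omit [NeZero N] [NeZero N'] in
/-- **Birch's lemma at the level of the ONE-TERM measures.** Let `χ` be a `ℚ`-valued multiplicative character mod `m`,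
`(m, p) = 1`, with `χ(p)² = 1`, `c ∈ ℚ`, and assume `hB : ∀ x, [x]⁺_g = c · Σ_{b mod m} χ(b) [x + b/m]⁺_f`. Then for every `n`,
`a mod pⁿ` and `b₁ mod 1`: `μ¹_{g, χ(p)α, 1}((a + pⁿℤ_p) × {b₁}) = c · Σ_{b mod m} χ(b) · μ¹_{f,α,m}((a·m + pⁿℤ_p) × {b})`
(`χ(pⁿ) = χ(p)ⁿ` against `(χ(p)α)^{−n}`, `χ(p)² = 1`). [cite: MazurTateTeitelbaum1986Invent, §I.8–I.10 (pp. 10–13)]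
[cite: Matsuno2000, §2 (p. 84)] -/
theorem msdMeasureTameMult_twist_eq_sum (hmp : m.Coprime p) (χ : MulChar (ZMod m) ℚ)
    (hχp : χ (p : ZMod m) ^ 2 = 1) {c : ℚ}
    (hB : ∀ x : ℚ, ratPlusSymbol g x = c * ∑ b : ZMod m, χ b * ratPlusSymbol f (x + (b.val : ℚ) / m))
    (α : ℚ_[p]) (n : ℕ) (a : ZMod (p ^ n)) (b₁ : ZMod 1) :
    msdMeasureTameMult g 1 (((χ (p : ZMod m) : ℚ) : ℚ_[p]) * α) n a b₁ =
      (c : ℚ_[p]) * ∑ b : ZMod m, ((χ b : ℚ) : ℚ_[p]) * msdMeasureTameMult f m α n (a * (m : ZMod (p ^ n))) b := by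
  have hinv : (((χ (p : ZMod m) : ℚ) : ℚ_[p]))⁻¹ = ((χ (p : ZMod m) : ℚ) : ℚ_[p]) := by
    have h2 : ((χ (p : ZMod m) : ℚ) : ℚ_[p]) * ((χ (p : ZMod m) : ℚ) : ℚ_[p]) = 1 := by
      rw [← Rat.cast_mul, ← pow_two, hχp, Rat.cast_one]
    exact inv_eq_of_mul_eq_one_right h2
  have hpow : χ ((p : ZMod m) ^ n) = χ (p : ZMod m) ^ n := map_pow χ _ n
  have key : (c : ℚ_[p]) * ∑ b : ZMod m, ((χ b : ℚ) : ℚ_[p]) *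
      (ratPlusSymbol f (tameFraction p m n (a * (m : ZMod (p ^ n))) b) : ℚ_[p]) =
      ((χ (p : ZMod m) : ℚ) : ℚ_[p]) ^ n * (ratPlusSymbol g ((a.val : ℚ) / (p : ℚ) ^ n) : ℚ_[p]) := by
    have h := sum_mul_ratPlusSymbol_tameFraction_eq f hmp χ n a
    rw [hpow] at h
    have h' := congrArg (fun q : ℚ ↦ ((c * q : ℚ) : ℚ_[p])) h
    rw [hB ((a.val : ℚ) / (p : ℚ) ^ n)]
    push_cast at h' ⊢
    rw [h']
    ring
  have hRHS : (c : ℚ_[p]) * ∑ b : ZMod m, ((χ b : ℚ) : ℚ_[p]) * msdMeasureTameMult f m α n (a * (m : ZMod (p ^ n))) b =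
      α⁻¹ ^ n * ((c : ℚ_[p]) * ∑ b : ZMod m, ((χ b : ℚ) : ℚ_[p]) *
        (ratPlusSymbol f (tameFraction p m n (a * (m : ZMod (p ^ n))) b) : ℚ_[p])) := by
    simp only [msdMeasureTameMult, Finset.mul_sum]
    refine Finset.sum_congr rfl fun b _ ↦ ?_
    ring
  rw [hRHS, key, msdMeasureTameMult_one, mul_inv, inv_pow, hinv]
  ring

omit [NeZero N] [NeZero N'] in
/-- **The one-term Riemann sums of the twist are `c` times the TRANSLATED weighted tame sums**: under `hB`, for
`m ≡ ω(m) γ^{e}` (`teich`, `hc`), `padicLRiemannSumTameMult g 1 (χ(p)α) 1 k n = c · Σ_ζ Σ_s ν_χ((ω(m)γ^{e})·(ζγˢ)) C(s,k)`,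
`ν_χ(x) = Σ_b χ(b) μ¹_{f,α,m}(x × {b})`. [cite: MazurTateTeitelbaum1986Invent, §I.8–I.13 (pp. 10–19)] -/
theorem padicLRiemannSumTameMult_twist_eq (hmp : m.Coprime p) (χ : MulChar (ZMod m) ℚ) (hχp : χ (p : ZMod m) ^ 2 = 1)
    {c : ℚ} (hB : ∀ x : ℚ, ratPlusSymbol g x = c * ∑ b : ZMod m, χ b * ratPlusSymbol f (x + (b.val : ℚ) / m))
    (α : ℚ_[p]) {teich : rootsOfUnity (torsionOrder p) ℤ_[p]} {e : ℤ_[p]}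
    (hc : ∀ n : ℕ, PadicInt.toZModPow (n + cyclotomicExponent p) ((teich : ℤ_[p]ˣ) : ℤ_[p]) *
        (cyclotomicGenerator p : ZMod (p ^ (n + cyclotomicExponent p))) ^ (PadicInt.toZModPow n e).val =
          (m : ZMod (p ^ (n + cyclotomicExponent p)))) (k n : ℕ) :
    padicLRiemannSumTameMult g 1 (((χ (p : ZMod m) : ℚ) : ℚ_[p]) * α) (1 : DirichletCharacter ℚ_[p] 1) k n =
      (c : ℚ_[p]) * ∑ᶠ zz : rootsOfUnity (torsionOrder p) ℤ_[p], ∑ s : ZMod (p ^ n),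
        (fun (n : ℕ) (a : ZMod (p ^ n)) ↦
            ∑ b : ZMod m, (χ.ringHomComp (Rat.castHom ℚ_[p])) b * msdMeasureTameMult f m α n a b)
          (n + cyclotomicExponent p)
          ((PadicInt.toZModPow (n + cyclotomicExponent p) ((teich : ℤ_[p]ˣ) : ℤ_[p]) *
              (cyclotomicGenerator p : ZMod (p ^ (n + cyclotomicExponent p))) ^ (PadicInt.toZModPow n e).val) *
            (PadicInt.toZModPow (n + cyclotomicExponent p) ((zz : ℤ_[p]ˣ) : ℤ_[p]) *
              (cyclotomicGenerator p : ZMod (p ^ (n + cyclotomicExponent p))) ^ s.val)) *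
          ((s.val.choose k : ℕ) : ℚ_[p]) := by
  classical
  haveI := neZero_torsionOrder p
  haveI := Fintype.ofFinite (rootsOfUnity (torsionOrder p) ℤ_[p])
  unfold padicLRiemannSumTameMult
  rw [finsum_eq_sum_of_fintype, finsum_eq_sum_of_fintype, Finset.mul_sum]
  refine Finset.sum_congr rfl fun zz _ ↦ ?_
  rw [Finset.mul_sum]
  refine Finset.sum_congr rfl fun s _ ↦ ?_
  rw [Fintype.sum_subsingleton _ (1 : ZMod 1), map_one, one_mul,
    msdMeasureTameMult_twist_eq_sum f g hmp χ hχp hB α, hc n,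
    mul_comm (m : ZMod (p ^ (n + cyclotomicExponent p)))]
  simp only [MulChar.ringHomComp_apply, eq_ratCast]
  ring

omit [NeZero N'] in
/-- **Birch's lemma for the one-term coefficients**: under `hB` and the convergence hypotheses for `f` (rational normalised
newform with `p ∣ N`, `(m,p) = 1`, `a_p(f) = α`, `‖α‖ = 1`),
`[T^k] L_p^{(1)}(g, χ(p)α) = c · Σ_{i≤k} (−f_m choose k−i) · [T^i] L_p(f, α, χ)`, `f_m = frobeniusExponent p m`.
[cite: MazurTateTeitelbaum1986Invent, §I.8–I.13 (pp. 10–19)] [cite: Matsuno2000, §2 (p. 84)] -/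
theorem padicLCoeffTameMult_twist_eq (hf : IsNewform0 f) (hQ : coeffField f = ⊥) (hpN : p ∣ N) (hmp : m.Coprime p)
    {ap : ℤ} (hap : cuspCoeff f p = ap) {α : ℚ_[p]} (hα : (ap : ℚ_[p]) = α) (hαu : ‖α‖ = 1)
    (χ : MulChar (ZMod m) ℚ) (hχp : χ (p : ZMod m) ^ 2 = 1) {c : ℚ}
    (hB : ∀ x : ℚ, ratPlusSymbol g x = c * ∑ b : ZMod m, χ b * ratPlusSymbol f (x + (b.val : ℚ) / m)) (k : ℕ) :
    padicLCoeffTameMult g 1 (((χ (p : ZMod m) : ℚ) : ℚ_[p]) * α) (1 : DirichletCharacter ℚ_[p] 1) k =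
      (c : ℚ_[p]) * ∑ i ∈ Finset.range (k + 1),
        algebraMap ℤ_[p] ℚ_[p] (Ring.choose (-frobeniusExponent p (m : ℤ_[p])) (k - i)) *
          padicLCoeffTameMult f m α (χ.ringHomComp (Rat.castHom ℚ_[p])) i := by
  classical
  set χp : DirichletCharacter ℚ_[p] m := χ.ringHomComp (Rat.castHom ℚ_[p]) with hχp_def
  have hα0 : α ≠ 0 := norm_ne_zero_iff.mp (by rw [hαu]; exact one_ne_zero)
  have hdist := sum_filter_weighted_msdMeasureTameMult_succ f hf (fun r ↦ ratCast_ratPlusSymbol_holds hf hQ r) hpN hmp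
    hap hα0 hα χp
  obtain ⟨C, hC⟩ := exists_norm_weighted_msdMeasureTameMult_le f
    (exists_nsmul_modularSymbol_mem_periodLattice_of_isNewform0 hf hQ) hαu χp
  obtain ⟨teich, hc⟩ := exists_teichmuller_frobeniusExponent p hmp
  have hRSdef : ∀ k n : ℕ, padicLRiemannSumTameMult f m α χp k n =
      ∑ᶠ zz : rootsOfUnity (torsionOrder p) ℤ_[p], ∑ s : ZMod (p ^ n),
        (fun (n : ℕ) (a : ZMod (p ^ n)) ↦ ∑ b : ZMod m, χp b * msdMeasureTameMult f m α n a b)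
          (n + cyclotomicExponent p)
          (PadicInt.toZModPow (n + cyclotomicExponent p) ((zz : ℤ_[p]ˣ) : ℤ_[p]) *
            (cyclotomicGenerator p : ZMod (p ^ (n + cyclotomicExponent p))) ^ s.val) *
          (s.val.choose k : ℚ_[p]) :=
    fun k n ↦ padicLRiemannSumTameMult_eq_sum_weighted f m α χp k n
  set RSz : ℕ → ℕ → ℚ_[p] := fun k n ↦ ∑ᶠ zz : rootsOfUnity (torsionOrder p) ℤ_[p], ∑ s : ZMod (p ^ n),
        (fun (n : ℕ) (a : ZMod (p ^ n)) ↦ ∑ b : ZMod m, χp b * msdMeasureTameMult f m α n a b)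
          (n + cyclotomicExponent p)
          ((PadicInt.toZModPow (n + cyclotomicExponent p) ((teich : ℤ_[p]ˣ) : ℤ_[p]) *
              (cyclotomicGenerator p : ZMod (p ^ (n + cyclotomicExponent p))) ^
                (PadicInt.toZModPow n (frobeniusExponent p (m : ℤ_[p]))).val) *
            (PadicInt.toZModPow (n + cyclotomicExponent p) ((zz : ℤ_[p]ˣ) : ℤ_[p]) *
              (cyclotomicGenerator p : ZMod (p ^ (n + cyclotomicExponent p))) ^ s.val)) *
          ((s.val.choose k : ℕ) : ℚ_[p]) with hRSz_def
  have hRSz : ∀ k n : ℕ, RSz k n = ∑ᶠ zz : rootsOfUnity (torsionOrder p) ℤ_[p], ∑ s : ZMod (p ^ n),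
        (fun (n : ℕ) (a : ZMod (p ^ n)) ↦ ∑ b : ZMod m, χp b * msdMeasureTameMult f m α n a b)
          (n + cyclotomicExponent p)
          ((PadicInt.toZModPow (n + cyclotomicExponent p) ((teich : ℤ_[p]ˣ) : ℤ_[p]) *
              (cyclotomicGenerator p : ZMod (p ^ (n + cyclotomicExponent p))) ^
                (PadicInt.toZModPow n (frobeniusExponent p (m : ℤ_[p]))).val) *
            (PadicInt.toZModPow (n + cyclotomicExponent p) ((zz : ℤ_[p]ˣ) : ℤ_[p]) *
              (cyclotomicGenerator p : ZMod (p ^ (n + cyclotomicExponent p))) ^ s.val)) *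
          ((s.val.choose k : ℕ) : ℚ_[p]) := fun k n ↦ by rw [hRSz_def]
  have hlim := tendsto_riemannSum_translate hdist hC hRSdef hRSz k
  have hRS : ∀ n, padicLRiemannSumTameMult g 1 (((χ (p : ZMod m) : ℚ) : ℚ_[p]) * α) 1 k n = (c : ℚ_[p]) * RSz k n :=
    fun n ↦ by
    rw [hRSz_def]
    exact padicLRiemannSumTameMult_twist_eq f g hmp χ hχp hB α hc k n
  have hT : Tendsto (padicLRiemannSumTameMult g 1 (((χ (p : ZMod m) : ℚ) : ℚ_[p]) * α) 1 k) atTop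
      (𝓝 ((c : ℚ_[p]) * ∑ i ∈ Finset.range (k + 1),
        algebraMap ℤ_[p] ℚ_[p] (Ring.choose (-frobeniusExponent p (m : ℤ_[p])) (k - i)) *
          limUnder atTop (fun n ↦ padicLRiemannSumTameMult f m α χp i n))) := by
    refine ((hlim.const_mul (c : ℚ_[p])).congr fun n ↦ ?_)
    exact (hRS n).symm
  rw [padicLCoeffTameMult, hT.limUnder_eq]
  rfl

omit [NeZero N'] in
/-- **Birch's lemma for the one-term transforms.** Under the symbol-level twisting relation
`hB : ∀ x, [x]⁺_g = c · Σ_{b mod m} χ(b) [x + b/m]⁺_f` (`χ` a `ℚ`-valued character mod `m`, `(m,p) = 1`, `χ(p)² = 1`) and the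
standing hypotheses on `f` (rational normalised newform, `p ∣ N`, `a_p(f) = α`, `‖α‖ = 1`):
`padicLFunctionTameMult g 1 (χ(p)α) 1 = C(c) · (1+T)^{−f_m} · padicLFunctionTameMult f m α χ` in `ℚ_p⟦T⟧`,
`f_m = frobeniusExponent p m` (`γ^{f_m} = ⟨m⟩`). [cite: MazurTateTeitelbaum1986Invent, §I.8–I.13 (pp. 10–19)]
[cite: Matsuno2000, §2 (p. 84)] -/
theorem padicLFunctionTameMult_twist_eq_of_birch (hf : IsNewform0 f) (hQ : coeffField f = ⊥) (hpN : p ∣ N)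
    (hmp : m.Coprime p) {ap : ℤ} (hap : cuspCoeff f p = ap) {α : ℚ_[p]} (hα : (ap : ℚ_[p]) = α) (hαu : ‖α‖ = 1)
    (χ : MulChar (ZMod m) ℚ) (hχp : χ (p : ZMod m) ^ 2 = 1) {c : ℚ}
    (hB : ∀ x : ℚ, ratPlusSymbol g x = c * ∑ b : ZMod m, χ b * ratPlusSymbol f (x + (b.val : ℚ) / m)) :
    padicLFunctionTameMult g 1 (((χ (p : ZMod m) : ℚ) : ℚ_[p]) * α) (1 : DirichletCharacter ℚ_[p] 1) =
      C (c : ℚ_[p]) * PowerSeries.binomialSeries ℚ_[p] (-frobeniusExponent p (m : ℤ_[p])) *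
        padicLFunctionTameMult f m α (χ.ringHomComp (Rat.castHom ℚ_[p])) := by
  ext k
  rw [coeff_padicLFunctionTameMult, padicLCoeffTameMult_twist_eq f g hf hQ hpN hmp hap hα hαu χ hχp hB k,
    coeff_C_mul_binomialSeries_mul]
  congr 1
  refine Finset.sum_congr rfl fun i _ ↦ ?_
  rw [coeff_padicLFunctionTameMult]

end Birch

end Literature.NumberTheory.EllipticCurves

end
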